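import Summits.QuantumFields.BalabanUV.Beta.FP.PerfectMaxwellDict
import Summits.QuantumFields.BalabanUV.Beta.FP.PerfectPropagatorSymbol

/-!
# `BalabanUV.Beta.FP.PerfectMaxwellDictMatrix` — road «FP» for binder row D1, leaf H2-P: JUNCTION of sub-rows H2-P-DICT (`PerfectMaxwellDict`, this seat)
# and H2-P-MAT (`PerfectPropagatorSymbol`, owner d1-p3-g4) — the bond-basis symbol matrix of `Δ_∞` IS the owner's weighted Maxwell matrix
# `maxwellMat (Re W_∞(·,·;s)) (d1Sym s)`, entry by entry; hence `Δ_∞` is the lattice kernel of `maxwellMat`, whose Feynman completion `feynMat` is the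
# matrix inverted by `PinfSym`

HONEST DEPENDENCY (page 1, mandatory): continuum YM on T⁴ ⇐ BetaPertH ∧ nine spine estimates (0/9 proved); BetaPertH ⇐ (D1) ∧ (D4) ∧ CAP+tail;
G-an2-4 gates asym, D1 and NE2/3/4.  HONEST FRAMING (cell contract, verbatim): «discharging `BetaPertH` makes Bałaban's UV stability UNCONDITIONAL —
a real constructive-QFT result; it is NOT the continuum limit and NOT the Clay problem.»  THIS MODULE DISCHARGES NOTHING of the wall: [folklore] finite-sum
algebra over `Fin (d+1)` joining two tree definitions BY NAME; 0 def; no `def … : Prop`; nothing cited; 0 sorry; 0 wall binders; NOT D1, NOT BetaPertH,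
NOT continuum, NOT Clay.  «not in print; our bookkeeping».

ABSOLUTE RULE (cell charter, verbatim): «No internally-minted statement may enter as a cited fact. Every hypothesis is either kernel-proved in this package or a
verbatim quotation of a PUBLISHED theorem with page reference. The manuscript(s) under audit are NOT citable for their own disputed steps — they are the thing
under adjudication; programme-internal (2001/route/tribunal) claims are never citable.»

WHAT.
* §1 `curlRow_eq_dirI` (the owner's curl row in indicator form), **`bondSymbol_eq_maxwellMat`**: if `Gf_{μν;ab}(p) = ½·W μ ν·conj(ph a)·ph b` (`μ ≠ ν`)
  then `bondSymbol Gf α β p = maxwellMat W ph α β` for all `α β` — the rank-one curl projector `conj(e_{μν}) ⊗ e_{μν}` of H2-P-MAT expands to EXACTLY the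
  four indicator terms of `DirichletExhaustionDeltaZ.summand` read on symbols.
* §2 **`bondSymbol_GsymInf_eq_maxwellMat`**: on the whole real zone, `bondSymbol GsymInf α β (ofRealVec s) = maxwellMat (Re W_∞(·,·;s)) (d1Sym s) α β`
  (`PerfectMaxwellDict.GsymInf_ofReal`); `bondSymbol_Gsym_eq_maxwellMat` (every finite level `n ≥ 1`, printed weights `w166 n · · s`).
* §3 **`deltaZLim_eq_re_integral_maxwellMat`**: `Δ_∞((x,α),(y,β)) = Re[(2π)^{−(d+1)} ∫_{[−π,π]^{d+1}} maxwellMat (Re W_∞(·,·;s)) (d1Sym s) α β · e^{i s·(x−y)} ds]`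
  — THE PERFECT EFFECTIVE LAPLACIAN IS THE LATTICE KERNEL OF THE OWNER's MATRIX SYMBOL (`deltaZLim_eq_re_latticeKernel` + §2 under the zone integral);
  `quad_maxwellMat_eq_quadForm_bondSymbol` (the two quadratic-form currencies agree: `quad (maxwellMat …) v = Σ conj(v α)·bondSymbol GsymInf α β·v β`).
Provenance: G-an2-4 swarm leaf prover 02, gen 34 (prover-b2b-balaban-gan24-formalise-leaf-02-g34-0), cross-lane on road FP's row H2-P-DICT (junction offered
journal l.19156 ∕ l.19317), 2026-08-20.
-/

noncomputable section

namespace Summit.QuantumFields.BalabanUV.Beta.FP.PerfectMaxwellDictMatrix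

open MeasureTheory Finset Complex
open scoped BigOperators ComplexConjugate
open Literature.MathematicalPhysics.QuantumFieldTheory.Balaban1983to89
open B4Strip (ofRealVec)
open B4ContourShift (BZ integrand fourierBox latticeKernel)
open B5Prop11Fiber (d1Sym)
open B5Bounds167Lattice (w166)
open B5Symbol166Strip (Gsym Gsym_ofReal Gsym_ofReal_zero)
open B4Sect5Exhaustion (K)
open Summit.QuantumFields.BalabanUV.Beta.GAN24.DirichletExhaustionDeltaZ (dirI)
open Summit.QuantumFields.BalabanUV.Beta.GAN24.EffectiveLaplacianLimit (deltaZLim measurableSet_BZ)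
open Summit.QuantumFields.BalabanUV.Beta.FP.PerfectSymbol166 (W166Inf)
open Summit.QuantumFields.BalabanUV.Beta.FP.PerfectSymbolKMultiplierClosed (GsymInf)
open Summit.QuantumFields.BalabanUV.Beta.FP.PerfectMaxwellDict (bondSymbol GsymInf_ofReal deltaZLim_eq_re_latticeKernel)
open Summit.QuantumFields.BalabanUV.Beta.FP.PerfectPropagatorSymbol (curlRow maxwellMat quad)

variable {d : ℕ}

/-! ## §1 The rank-one curl projector in indicator form -/

/-- [folklore] The owner's curl row in the indicator currency of `DirichletExhaustionDeltaZ`: `curlRow ph μ ν α = ph μ·ι_{να} − ph ν·ι_{μα}`. -/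
theorem curlRow_eq_dirI (ph : Fin (d + 1) → ℂ) (μ ν α : Fin (d + 1)) :
    curlRow ph μ ν α = ph μ * ((dirI ν α : ℝ) : ℂ) - ph ν * ((dirI μ α : ℝ) : ℂ) := by
  unfold curlRow dirI
  rcases eq_or_ne α ν with rfl | h1 <;> rcases eq_or_ne α μ with rfl | h2
  · simp
  · simp [h2, Ne.symm h2]
  · simp [h1, Ne.symm h1]
  · simp [h1, Ne.symm h1, h2, Ne.symm h2]

/-- [folklore] **THE BOND-BASIS SYMBOL MATRIX IS THE WEIGHTED MAXWELL MATRIX**: if the entry symbols factor as `Gf_{μν;ab}(p) = ½·W μ ν·conj(ph a)·ph b`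
(`μ ≠ ν`), then `bondSymbol Gf α β p = maxwellMat W ph α β` — the rank-one term `½W_{μν}·conj(e_{μν})_α·(e_{μν})_β` is exactly
`ι_{να}ι_{νβ}Gf_{μν;μμ} − ι_{να}ι_{μβ}Gf_{μν;μν} − ι_{μα}ι_{νβ}Gf_{μν;νμ} + ι_{μα}ι_{μβ}Gf_{μν;νν}`. -/
theorem bondSymbol_eq_maxwellMat {Gf : Fin (d + 1) → Fin (d + 1) → Fin (d + 1) → Fin (d + 1) → (Fin (d + 1) → ℂ) → ℂ}
    {W : Fin (d + 1) → Fin (d + 1) → ℝ} {ph : Fin (d + 1) → ℂ} {p : Fin (d + 1) → ℂ}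
    (hG : ∀ μ ν, μ ≠ ν → ∀ a b, Gf μ ν a b p = 1 / 2 * (W μ ν : ℂ) * (conj (ph a) * ph b)) (α β : Fin (d + 1)) :
    bondSymbol Gf α β p = maxwellMat W ph α β := by
  unfold bondSymbol maxwellMat
  refine Finset.sum_congr rfl fun μ _ => Finset.sum_congr rfl fun ν _ => ?_
  by_cases h : μ = ν
  · simp [h]
  · simp only [h, if_false, hG μ ν h, curlRow_eq_dirI, map_sub, map_mul, conj_ofReal]
    push_cast
    ring

/-! ## §2 At the continuum (1.66) weights and at every finite level -/

/-- [our object] **ON THE WHOLE REAL ZONE THE SYMBOL MATRIX OF `Δ_∞` IS `maxwellMat (Re W_∞(·,·;s)) (d1Sym s)`** (H2-P-DICT's `GsymInf_ofReal` feeds §1). -/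
theorem bondSymbol_GsymInf_eq_maxwellMat {s : Fin (d + 1) → ℝ} (hs : s ∈ BZ (d + 1)) (α β : Fin (d + 1)) :
    bondSymbol GsymInf α β (ofRealVec s) = maxwellMat (fun μ ν => (W166Inf μ ν (ofRealVec s)).re) (d1Sym s) α β :=
  bondSymbol_eq_maxwellMat (fun _ _ h a b => GsymInf_ofReal h a b hs) α β

/-- [our object] The same at every finite level `n ≥ 1` with the PRINTED weights `w166 n · · s` (the symbol matrix of Bałaban's `Δ_k`, `n = L^k`). -/
theorem bondSymbol_Gsym_eq_maxwellMat (n : ℕ) [NeZero n] {s : Fin (d + 1) → ℝ} (hs : s ∈ BZ (d + 1)) (α β : Fin (d + 1)) :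
    bondSymbol (fun μ ν a b p => Gsym n μ ν a b p) α β (ofRealVec s) = maxwellMat (fun μ ν => w166 n μ ν s) (d1Sym s) α β := by
  refine bondSymbol_eq_maxwellMat (fun μ ν h a b => ?_) α β
  by_cases h0 : s = 0
  · subst h0
    have e : Gsym n μ ν a b (ofRealVec (0 : Fin (d + 1) → ℝ)) = 0 := Gsym_ofReal_zero n μ ν a b
    rw [e]; simp [d1Sym]
  · obtain ⟨ν₀, hν₀⟩ : ∃ ν₀, s ν₀ ≠ 0 := by
      by_contra hall
      push Not at hall
      exact h0 (funext hall)
    exact Gsym_ofReal n h a b s (fun κ => abs_le.mpr ⟨hs.1 κ, hs.2 κ⟩) ν₀ hν₀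

/-! ## §3 `Δ_∞` is the lattice kernel of `maxwellMat`; the two quadratic-form currencies agree -/

/-- [our object] **THE PERFECT EFFECTIVE LAPLACIAN IS THE LATTICE KERNEL OF THE OWNER's MATRIX SYMBOL**: for all bonds `b = (x,α)`, `b′ = (y,β)`,
`Δ_∞ b b′ = Re[(2π)^{−(d+1)} · ∫_{[−π,π]^{d+1}} maxwellMat (Re W_∞(·,·;s)) (d1Sym s) α β · e^{i s·(x−y)} ds]`. -/
theorem deltaZLim_eq_re_integral_maxwellMat (b b' : K (d + 1) (d + 1)) :
    deltaZLim (d := d) b b' = ((((2 * Real.pi) ^ (d + 1))⁻¹ : ℝ) • ∫ s in BZ (d + 1),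
      maxwellMat (fun μ ν => (W166Inf μ ν (ofRealVec s)).re) (d1Sym s) b.2 b'.2 * cexp (I * B4ContourShift.phase s (b.1 - b'.1))).re := by
  rw [deltaZLim_eq_re_latticeKernel]
  unfold latticeKernel fourierBox
  congr 2
  refine setIntegral_congr_fun (measurableSet_BZ d) fun s hs => ?_
  unfold integrand
  rw [bondSymbol_GsymInf_eq_maxwellMat hs]

/-- [our object] THE TWO QUADRATIC-FORM CURRENCIES AGREE on the real zone: the owner's `quad (maxwellMat …) v` IS H2-P-DICT's `Σ conj(v α)·bondSymbol GsymInf α β·v β`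
(both equal `↑(maxwellQ (Re W_∞) (d1Sym s) v)` — `PerfectPropagatorSymbol.quad_maxwellMat`, `PerfectMaxwellDict.quadForm_bondSymbol_GsymInf`). -/
theorem quad_maxwellMat_eq_quadForm_bondSymbol {s : Fin (d + 1) → ℝ} (hs : s ∈ BZ (d + 1)) (v : Fin (d + 1) → ℂ) :
    quad (maxwellMat (fun μ ν => (W166Inf μ ν (ofRealVec s)).re) (d1Sym s)) v =
      ∑ α, ∑ β, conj (v α) * bondSymbol GsymInf α β (ofRealVec s) * v β := by
  unfold quad
  simp_rw [bondSymbol_GsymInf_eq_maxwellMat hs]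

end Summit.QuantumFields.BalabanUV.Beta.FP.PerfectMaxwellDictMatrix

end
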